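import Literature.NumberTheory.EllipticCurves.DivisionPolynomialFormalMulProofs
import Literature.NumberTheory.EllipticCurves.TorsionCardinality
import Literature.NumberTheory.EllipticCurves.GeomPointReduction
import Literature.NumberTheory.EllipticCurves.GlobalMinimalModel
import Mathlib.RingTheory.Polynomial.Vieta
import HarnessLib

/-!
# The valuation of the non-integral `p`-torsion at a place of height-one reduction
# (Serre 1972, §1.11 (`e = 1`, "hauteur 1"); Silverman *AEC* IV.6.1, VII.3)

`Proofs` file (theorems only, no definitions, no named facts), topic `NumberTheory/EllipticCurves`;
the ORDINARY / MULTIPLICATIVE sibling of `SupersingularTorsionValuationProofs` (which treats the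
height-two case, where EVERY point of order `p` lies in the kernel of reduction at level
`1/(p² - 1)`).

Let `(L, w)` be a valued field, `p` an odd prime with `w p < 1` and `p ≠ 0` in `L`, and `V/L` a
Weierstrass equation whose `p`-division polynomial `ψ_p = preΨ'_p` (Mathlib; degree `(p² - 1)/2`,
leading coefficient `p`) has `w`-integral coefficients, a UNIT coefficient in degree
`d = (p² - p)/2` and coefficients of valuation `≤ w p` above that degree.  This is the shape of
`ψ_p` for an integral equation whose reduction has NON-ZERO Hasse invariant `A_p` (the reduction
`ψ̄_p` has degree exactly `(p² - p)/2` with leading coefficient `± A_p`: tree theorem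
`WeierstrassCurve.natDegree_ΨSq_eq_of_hasseCoeff_ne_zero`, Silverman *AEC* V.3.1(a)/V.4.1(a) in
division-polynomial form) over an absolutely unramified base (`e = 1`: the non-unit integers are
divisible by `p`) — both at a prime of good ORDINARY reduction and at a prime of MULTIPLICATIVE
reduction (the Hasse invariant of a nodal cubic is non-zero, tree
`WeierstrassCurve.hasseCoeff_ne_zero_of_node`: "the multiplicative group is ordinary").  Then:

* `Literature.NumberTheory.EllipticCurves.mul_pow_eq_one_of_eval_eq_zero_of_one_lt` — generic
  two-segment domination: for `f = Σ cᵢ xⁱ` of degree `≤ n` with `|cᵢ| ≤ 1` (`i < d`),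
  `|c_d| = 1`, `|cᵢ| ≤ |cₙ|` (`d < i < n`), **every root `x` with `|x| > 1` has
  `|cₙ|·|x|^{n-d} = 1`** (the two dominating terms are `c_d x^d` and `cₙ xⁿ`);
* `WeierstrassCurve.mul_pow_eq_one_of_prime_zsmul_eq_zero_of_one_lt` — hence **every affine point
  `P = (x, y)` with `p • P = O` and `|x| > 1` has `|p|·|x|^{(p-1)/2} = 1`**, i.e. the points of
  order `p` in the kernel of reduction (`|x| > 1`, Silverman *AEC* VII.2) sit at the level
  `|z| = |p|^{1/(p-1)}` of the formal group (`|x|·|z|² = 1`): Serre 1972, §1.11, case `e = 1` of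
  height `1` (the `p - 1` non-trivial points of the "canonical subgroup" `Ê[p] ≅ μ_p`), Silverman
  *AEC* Thm. IV.6.1 (`v(z) ≤ v(p)/(p - 1)`, here with equality);
* `Literature.NumberTheory.EllipticCurves.exists_one_lt_of_eval_eq_zero` — conversely such a
  polynomial HAS a root of valuation `> 1` over an algebraically closed `L` (Vieta: the unit
  coefficient `c_d = ± cₙ · e_{n-d}(roots)` would otherwise have valuation `≤ |cₙ| < 1`), so
  `WeierstrassCurve.exists_prime_zsmul_eq_zero_one_lt` — **there is a point of order `p` with
  `|x| > 1`** (Silverman *AEC* V.3.1(a): `Ẽ[p] ≠ E[p]` at an ordinary / nodal reduction);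
* `WeierstrassCurve.not_dvd_coeff_preΨ'_and_dvd_of_hasseCoeff_ne_zero` — the shape of `ψ_p` for a
  Weierstrass equation over `ℤ` whose reduction mod `p` has non-zero Hasse invariant;
* `WeierstrassCurve.valuation_placeOver_mul_pow_eq_one_of_prime_zsmul_eq_zero`,
  `WeierstrassCurve.exists_prime_zsmul_eq_zero_one_lt_valuation_placeOver` — the two statements for
  a GLOBALLY MINIMAL `W/ℚ` at the tree's place `placeOver p` of `ℚ̄` (`GeomPointReduction`), under
  the hypothesis `A_p(W_ℤ mod p) ≠ 0`.

## References

* [Serre1972] J.-P. Serre, *Propriétés galoisiennes des points d'ordre fini des courbes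
  elliptiques*, Invent. Math. 15 (1972), §1.11 (Prop. 11, Cor.; `e = 1`) with §1.9–1.10.
* [SilvermanAEC2009] J. H. Silverman, *The Arithmetic of Elliptic Curves*, 2nd ed. (2009),
  Thm. IV.6.1, V.3.1(a), V.4.1(a), VII.2–VII.3, Exercise 3.7.

## Design

No definitions; `noncomputable section`; a general value group `Γ₀` (the consumers use the
valuation of the valuation subring `placeOver p ⊂ ℚ̄`).  The hypothesis "reduction of height one"
enters only through the shape of `ψ_p`, produced from `A_p ≠ 0` for a `ℤ`-model in
`not_dvd_coeff_preΨ'_and_dvd_of_hasseCoeff_ne_zero`.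
-/

noncomputable section

open scoped Classical
open Polynomial

universe u

namespace Literature.NumberTheory.EllipticCurves

variable {L : Type u} [Field L] {Γ₀ : Type*} [LinearOrderedCommGroupWithZero Γ₀]
  {w : Valuation L Γ₀}

/-- **Two-segment domination for a big root.**  Let `f = Σᵢ cᵢ xⁱ` have degree `≤ n` over a
valued field, `d < n`, with `|cᵢ| ≤ 1` for `i < d`, `|c_d| = 1` and `|cᵢ| ≤ |cₙ|` for
`d < i < n`.  Then every root `x` with `|x| > 1` satisfies `|cₙ|·|x|^{n - d} = 1`: the terms of
index `≤ d` sum to an element of valuation `|x|^d` (dominated by `c_d x^d`), the terms of index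
`> d` to an element of valuation `|cₙ|·|x|ⁿ` (dominated by `cₙ xⁿ`), and the two must cancel.
This is the last segment of the Newton polygon of `f` (Neukirch, *ANT*, Ch. II (6.3): the
valuations of the roots are the slopes of the Newton polygon), in the elementary form needed here.
[cite: NeukirchANT1999, Ch. II Prop. (6.3)] -/
theorem mul_pow_eq_one_of_eval_eq_zero_of_one_lt {f : L[X]} {n d : ℕ} (hdn : d < n)
    (hn : f.natDegree ≤ n) (hlow : ∀ i < d, w (f.coeff i) ≤ 1) (hd : w (f.coeff d) = 1)
    (hmid : ∀ i, d < i → i < n → w (f.coeff i) ≤ w (f.coeff n)) {x : L}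
    (hx : f.eval x = 0) (h1 : 1 < w x) : w (f.coeff n) * w x ^ (n - d) = 1 := by
  have hx0 : x ≠ 0 := by
    rintro rfl
    rw [map_zero] at h1
    exact not_lt_zero h1
  have hwx0 : w x ≠ 0 := (Valuation.ne_zero_iff w).mpr hx0
  have hwxpos : ∀ k : ℕ, 0 < w x ^ k := fun k ↦ pow_pos (zero_lt_iff.mpr hwx0) k
  -- the two partial sums
  set A := ∑ i ∈ Finset.range (d + 1), f.coeff i * x ^ i with hA
  set B := ∑ i ∈ Finset.Ico (d + 1) (n + 1), f.coeff i * x ^ i with hB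
  have hsum : f.eval x = A + B := by
    rw [eval_eq_sum_range' (Nat.lt_succ_of_le hn), hA, hB, Finset.range_eq_Ico, Finset.range_eq_Ico,
      ← Finset.sum_Ico_consecutive _ (Nat.zero_le (d + 1)) (by omega : d + 1 ≤ n + 1)]
  -- `|A| = |x|^d`
  have hwA : w A = w x ^ d := by
    rw [hA, Finset.sum_range_succ]
    have hlt : w (∑ i ∈ Finset.range d, f.coeff i * x ^ i) < w (f.coeff d * x ^ d) := by
      rw [map_mul, map_pow, hd, one_mul]
      refine Valuation.map_sum_lt w (hwxpos d).ne' fun i hi ↦ ?_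
      rw [Finset.mem_range] at hi
      rw [map_mul, map_pow]
      calc w (f.coeff i) * w x ^ i ≤ 1 * w x ^ i := mul_le_mul' (hlow i hi) le_rfl
        _ = w x ^ i := one_mul _
        _ < w x ^ d := pow_lt_pow_right₀ h1 hi
    rw [Valuation.map_add_eq_of_lt_right w hlt, map_mul, map_pow, hd, one_mul]
  -- hence `B ≠ 0`, so the top coefficient is non-zero
  have hAB : A = -B := by
    rw [hx] at hsum
    exact eq_neg_of_add_eq_zero_left hsum.symm
  have hwB : w B = w x ^ d := by rw [← Valuation.map_neg, ← hAB, hwA]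
  have hcn : f.coeff n ≠ 0 := by
    intro hcn
    have hB0 : B = 0 := by
      refine Finset.sum_eq_zero fun i hi ↦ ?_
      rw [Finset.mem_Ico] at hi
      rcases lt_or_eq_of_le (Nat.le_of_lt_succ hi.2) with hin | rfl
      · have := hmid i (by omega) hin
        rw [hcn, map_zero, le_zero_iff, map_eq_zero] at this
        rw [this, zero_mul]
      · rw [hcn, zero_mul]
    rw [hB0, map_zero] at hwB
    exact (hwxpos d).ne' hwB.symm
  have hcn0 : 0 < w (f.coeff n) := (Valuation.pos_iff _).mpr hcn
  -- `|B| = |cₙ| |x|ⁿ`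
  have hwB' : w B = w (f.coeff n) * w x ^ n := by
    have htop0 : w (f.coeff n * x ^ n) ≠ 0 :=
      (Valuation.ne_zero_iff _).mpr (mul_ne_zero hcn (pow_ne_zero _ hx0))
    have hsplit : B = (∑ i ∈ Finset.Ico (d + 1) n, f.coeff i * x ^ i) + f.coeff n * x ^ n := by
      rw [hB, Finset.sum_Ico_succ_top (by omega)]
    have hlt : w (∑ i ∈ Finset.Ico (d + 1) n, f.coeff i * x ^ i) < w (f.coeff n * x ^ n) := by
      refine Valuation.map_sum_lt w htop0 fun i hi ↦ ?_
      rw [Finset.mem_Ico] at hi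
      rw [map_mul, map_pow, map_mul, map_pow]
      calc w (f.coeff i) * w x ^ i ≤ w (f.coeff n) * w x ^ i :=
            mul_le_mul' (hmid i (by omega) hi.2) le_rfl
        _ < w (f.coeff n) * w x ^ n :=
            mul_lt_mul_of_pos_left (pow_lt_pow_right₀ h1 hi.2) hcn0
    rw [hsplit, Valuation.map_add_eq_of_lt_right w hlt, map_mul, map_pow]
  -- compare
  rw [hwB'] at hwB
  obtain ⟨k, rfl⟩ : ∃ k, n = d + k := ⟨n - d, by omega⟩
  rw [Nat.add_sub_cancel_left]
  rw [pow_add, ← mul_assoc, mul_comm (w (f.coeff (d + k))), mul_assoc] at hwB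
  have := mul_left_cancel₀ (hwxpos d).ne' (hwB.trans (mul_one _).symm)
  exact this

/-- If every element of a multiset has valuation `≤ 1`, so does every elementary symmetric
function of it. [folklore] -/
private theorem map_esymm_le_one {s : Multiset L} (hs : ∀ a ∈ s, w a ≤ 1) (k : ℕ) :
    w (s.esymm k) ≤ 1 := by
  rw [Multiset.esymm]
  -- a sum of products of elements of valuation `≤ 1`
  have hprod' : ∀ t : Multiset L, (∀ b ∈ t, w b ≤ 1) → w t.prod ≤ 1 := by
    intro t
    induction t using Multiset.induction_on with
    | empty => intro _; simp
    | cons b t ih =>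
      intro ht
      rw [Multiset.prod_cons, map_mul]
      exact mul_le_one' (ht b (Multiset.mem_cons_self b t))
        (ih fun c hc ↦ ht c (Multiset.mem_cons_of_mem hc))
  have hprod : ∀ t ∈ Multiset.powersetCard k s, w t.prod ≤ 1 := by
    intro t ht
    have hts : t ≤ s := (Multiset.mem_powersetCard.mp ht).1
    exact hprod' t fun b hb ↦ hs b (Multiset.mem_of_le hts hb)
  have key : ∀ u : Multiset L, (∀ b ∈ u, w b ≤ 1) → w u.sum ≤ 1 := by
    intro u
    induction u using Multiset.induction_on with
    | empty => intro _; simp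
    | cons b u ih =>
      intro hu
      rw [Multiset.sum_cons]
      exact (w.map_add b u.sum).trans (max_le (hu b (Multiset.mem_cons_self b u))
        (ih fun c hc ↦ hu c (Multiset.mem_cons_of_mem hc)))
  refine key _ fun b hb ↦ ?_
  obtain ⟨t, ht, rfl⟩ := Multiset.mem_map.mp hb
  exact hprod t ht

/-- **Existence of a big root.**  Over an algebraically closed valued field, a polynomial `f` of
degree `n > d` with `|c_d| = 1` and `|cₙ| < 1` has a root of valuation `> 1`: otherwise Vieta
(`c_d = ± cₙ · e_{n-d}(roots)`, Mathlib `Polynomial.coeff_eq_esymm_roots_of_splits`) gives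
`|c_d| ≤ |cₙ| < 1`; equivalently, the Newton polygon of `f` has a segment of negative slope
beyond the vertex `(d, 0)` (Neukirch, *ANT*, Ch. II (6.3)). [cite: NeukirchANT1999, Ch. II Prop. (6.3)] -/
theorem exists_one_lt_of_eval_eq_zero [IsAlgClosed L] {f : L[X]} {n d : ℕ} (hdn : d < n)
    (hn : f.natDegree = n) (hd : w (f.coeff d) = 1) (htop : w (f.coeff n) < 1) :
    ∃ x : L, f.eval x = 0 ∧ 1 < w x := by
  by_contra hcon
  push Not at hcon
  have hroots : ∀ a ∈ f.roots, w a ≤ 1 := by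
    intro a ha
    have hf0 : f ≠ 0 := by
      rintro rfl
      rw [coeff_zero, map_zero] at hd
      exact zero_ne_one hd
    exact hcon a ((mem_roots hf0).mp ha)
  have hsplit : f.Splits := IsAlgClosed.splits f
  have hvieta := Polynomial.coeff_eq_esymm_roots_of_splits hsplit (k := d) (by rw [hn]; exact hdn.le)
  rw [hn, leadingCoeff, hn] at hvieta
  have hle : w (f.coeff d) ≤ w (f.coeff n) := by
    rw [hvieta, map_mul, map_mul, map_pow, Valuation.map_neg, Valuation.map_one, one_pow, mul_one]
    calc w (f.coeff n) * w (f.roots.esymm (n - d)) ≤ w (f.coeff n) * 1 :=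
          mul_le_mul_right (map_esymm_le_one hroots _) _
      _ = w (f.coeff n) := mul_one _
  rw [hd] at hle
  exact (lt_irrefl _) (lt_of_le_of_lt hle htop)

end Literature.NumberTheory.EllipticCurves

namespace WeierstrassCurve

open Literature.NumberTheory.EllipticCurves

variable {L : Type u} [Field L] {Γ₀ : Type*} [LinearOrderedCommGroupWithZero Γ₀]
  {w : Valuation L Γ₀}

/-- The degree bookkeeping for an odd prime `p`: `(p² - 1)/2 = (p² - p)/2 + (p - 1)/2` and
`(p² - p)/2 < (p² - 1)/2`. [folklore] -/
private theorem sq_sub_one_div_two_eq {p : ℕ} (hp : p.Prime) (hp2 : p ≠ 2) :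
    (p ^ 2 - 1) / 2 = (p ^ 2 - p) / 2 + (p - 1) / 2 ∧ (p ^ 2 - p) / 2 < (p ^ 2 - 1) / 2 := by
  obtain ⟨k, hk⟩ := hp.odd_of_ne_two hp2
  subst hk
  have h1 : (2 * k + 1) ^ 2 - 1 = 2 * (2 * k ^ 2 + 2 * k) := by ring_nf; omega
  have h2 : (2 * k + 1) ^ 2 - (2 * k + 1) = 2 * (2 * k ^ 2 + k) := by ring_nf; omega
  have h3 : 2 * k + 1 - 1 = 2 * k := by omega
  rw [h1, h2, h3, Nat.mul_div_cancel_left _ two_pos, Nat.mul_div_cancel_left _ two_pos,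
    Nat.mul_div_cancel_left _ two_pos]
  have hk : 0 < k := by
    have := hp.two_le
    omega
  omega

/-- **`|p|·|x(P)|^{(p-1)/2} = 1` for the points of order `p` OFF the integral locus**
(Serre 1972, §1.11, `e = 1`, height one; Silverman *AEC* IV.6.1 / VII.3).  Let `V` be a
Weierstrass equation over a valued field `(L, w)`, `p` an odd prime with `p ≠ 0` in `L`, and
suppose the `p`-division polynomial `ψ_p = preΨ'_p` of `V` has all coefficients of valuation
`≤ 1`, a coefficient of valuation `1` in degree `(p² - p)/2`, and coefficients of valuation
`≤ |p|` in every higher degree (the shape at a place of height-one reduction over an absolutely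
unramified base).  Then every affine point `P = (x, y)` with `p • P = O` and `|x| > 1` satisfies
`|p|·|x|^{(p-1)/2} = 1` (`ψ_p(x)² = ΨSq_p(x) = 0`, `zsmul_some_eq_zero_iff_eval_ΨSq`; `ψ_p` has
degree `(p² - 1)/2` and leading coefficient `p`, Mathlib `natDegree_preΨ'`, `coeff_preΨ'`; then
`mul_pow_eq_one_of_eval_eq_zero_of_one_lt`).
[cite: Serre1972, §1.11 (Prop. 11, Cor.)] [cite: SilvermanAEC2009, Thm. IV.6.1] -/
theorem mul_pow_eq_one_of_prime_zsmul_eq_zero_of_one_lt (V : WeierstrassCurve L) {p : ℕ}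
    [hp : Fact p.Prime] (hp2 : p ≠ 2) (hpL : (p : L) ≠ 0)
    (hcoef : ∀ i, w ((V.preΨ' p).coeff i) ≤ 1)
    (hd : w ((V.preΨ' p).coeff ((p ^ 2 - p) / 2)) = 1)
    (hhigh : ∀ i, (p ^ 2 - p) / 2 < i → w ((V.preΨ' p).coeff i) ≤ w p)
    {x y : L} {h : V.toAffine.Nonsingular x y}
    (hP : (p : ℤ) • (Affine.Point.some x y h : V.toAffine.Point) = 0) (hx : 1 < w x) :
    w p * w x ^ ((p - 1) / 2) = 1 := by
  have hodd : ¬ Even p := Nat.not_even_iff_odd.mpr (hp.out.odd_of_ne_two hp2)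
  obtain ⟨hsum, hlt⟩ := sq_sub_one_div_two_eq hp.out hp2
  set n : ℕ := (p ^ 2 - 1) / 2 with hn
  set d : ℕ := (p ^ 2 - p) / 2 with hdd
  have hdeg : (V.preΨ' p).natDegree = n := by
    rw [natDegree_preΨ' _ hpL, if_neg hodd]
  have hlead : (V.preΨ' p).coeff n = p := by
    have := V.coeff_preΨ' p
    rw [if_neg hodd, if_neg hodd] at this
    exact this
  -- `ψ_p(x) = 0`
  have hΨ : (V.ΨSq p).eval x = 0 := (V.zsmul_some_eq_zero_iff_eval_ΨSq h p).mp hP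
  have hroot : (V.preΨ' p).eval x = 0 := by
    rw [V.ΨSq_ofNat p, if_neg hodd, mul_one, eval_pow] at hΨ
    exact pow_eq_zero_iff two_ne_zero |>.mp hΨ
  have key := mul_pow_eq_one_of_eval_eq_zero_of_one_lt (w := w) hlt hdeg.le
    (fun i _ ↦ hcoef i) hd (fun i hi _ ↦ by rw [hlead]; exact hhigh i hi) hroot hx
  rw [hlead, hsum, Nat.add_sub_cancel_left] at key
  exact key

/-- **A point of order `p` off the integral locus exists** (over an algebraically closed valued
field, `p` odd, `|p| < 1`, `p ≠ 0` in `L`): if `ψ_p` has a coefficient of valuation `1` in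
degree `(p² - p)/2`, it has a root `x` with `|x| > 1` (`exists_one_lt_of_eval_eq_zero`: its top
coefficient is `p`, of valuation `< 1`), which is the abscissa of a point `P` with `p • P = O`
(Silverman *AEC* V.3.1(a): at a reduction of height one, `E[p] ⊄ E(𝒪)`). The point is produced
on ANY equation whose points with `ψ_p(x) = 0` are `p`-torsion, so nonsingularity of `V` is
assumed. [cite: SilvermanAEC2009, V.3.1(a) and Exercise 3.7] -/
theorem exists_prime_zsmul_eq_zero_one_lt [IsAlgClosed L] (V : WeierstrassCurve L) [V.IsElliptic]
    {p : ℕ} [hp : Fact p.Prime] (hp2 : p ≠ 2) (hpL : (p : L) ≠ 0) (hpw : w p < 1)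
    (hd : w ((V.preΨ' p).coeff ((p ^ 2 - p) / 2)) = 1) :
    ∃ (x y : L) (h : V.toAffine.Nonsingular x y),
      (p : ℤ) • (Affine.Point.some x y h : V.toAffine.Point) = 0 ∧ 1 < w x := by
  have hodd : ¬ Even p := Nat.not_even_iff_odd.mpr (hp.out.odd_of_ne_two hp2)
  obtain ⟨-, hlt⟩ := sq_sub_one_div_two_eq hp.out hp2
  have hdeg : (V.preΨ' p).natDegree = (p ^ 2 - 1) / 2 := by
    rw [natDegree_preΨ' _ hpL, if_neg hodd]
  have hlead : (V.preΨ' p).coeff ((p ^ 2 - 1) / 2) = p := by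
    have := V.coeff_preΨ' p
    rw [if_neg hodd, if_neg hodd] at this
    exact this
  obtain ⟨x, hx, h1⟩ := exists_one_lt_of_eval_eq_zero (w := w) hlt hdeg hd (by rw [hlead]; exact hpw)
  -- a point with abscissa `x`
  obtain ⟨y, hy⟩ : ∃ y : L, V.toAffine.Equation x y := by
    set q : L[X] := C 1 * X ^ 2 + C (V.toAffine.a₁ * x + V.toAffine.a₃) * X +
      C (-(x ^ 3 + V.toAffine.a₂ * x ^ 2 + V.toAffine.a₄ * x + V.toAffine.a₆)) with hq
    have hqdeg : q.degree = 2 := Polynomial.degree_quadratic one_ne_zero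
    obtain ⟨y, hy⟩ := IsAlgClosed.exists_root q (by rw [hqdeg]; norm_num)
    refine ⟨y, ?_⟩
    rw [WeierstrassCurve.Affine.equation_iff]
    rw [IsRoot, hq] at hy
    simp only [eval_add, eval_mul, eval_C, eval_pow, eval_X, one_mul] at hy
    linear_combination hy
  have hns : V.toAffine.Nonsingular x y :=
    (WeierstrassCurve.Affine.equation_iff_nonsingular (W := V.toAffine)).mp hy
  refine ⟨x, y, hns, ?_, h1⟩
  rw [V.zsmul_some_eq_zero_iff_eval_ΨSq hns p, V.ΨSq_ofNat p, if_neg hodd, mul_one, eval_pow, hx,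
    zero_pow two_ne_zero]

/-- **The shape of `ψ_p` at a reduction of height one, for a `ℤ`-model.**  Let `M` be a
Weierstrass equation over `ℤ` and `p` an odd prime such that the Hasse invariant of `M mod p` is
non-zero (good ORDINARY reduction, or a NODE: `hasseCoeff_ne_zero_of_node`).  Then the
coefficient of `ψ_p(M) = preΨ'_p` in degree `(p² - p)/2` is prime to `p` and all higher
coefficients are divisible by `p`: the reduction `ψ̄_p = preΨ'_p(M mod p)` satisfies
`ψ̄_p² = ΨSq_p`, of degree exactly `p² - p` with leading coefficient `A_p²`
(`natDegree_ΨSq_eq_of_hasseCoeff_ne_zero`; Silverman *AEC* V.3.1(a), V.4.1(a)).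
[cite: SilvermanAEC2009, V.3.1(a) and V.4.1(a)] -/
theorem not_dvd_coeff_preΨ'_and_dvd_of_hasseCoeff_ne_zero (M : WeierstrassCurve ℤ) {p : ℕ}
    [hp : Fact p.Prime] (hp2 : p ≠ 2)
    (hA : (M.map (Int.castRingHom (ZMod p))).hasseCoeff p ≠ 0) :
    ¬ (p : ℤ) ∣ (M.preΨ' p).coeff ((p ^ 2 - p) / 2) ∧
      ∀ i, (p ^ 2 - p) / 2 < i → (p : ℤ) ∣ (M.preΨ' p).coeff i := by
  have hodd : ¬ Even p := Nat.not_even_iff_odd.mpr (hp.out.odd_of_ne_two hp2)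
  set V := M.map (Int.castRingHom (ZMod p)) with hV
  have hΨ : V.preΨ' p = (M.preΨ' p).map (Int.castRingHom (ZMod p)) := by
    rw [hV, map_preΨ']
  obtain ⟨hdeg, hlc⟩ := WeierstrassCurve.natDegree_ΨSq_eq_of_hasseCoeff_ne_zero p V hp2 hA
  have hsq : V.ΨSq p = V.preΨ' p ^ 2 := by
    rw [V.ΨSq_ofNat p, if_neg hodd, mul_one]
  have hne : V.preΨ' p ≠ 0 := by
    intro h0
    rw [hsq, h0, zero_pow two_ne_zero, leadingCoeff_zero] at hlc
    exact hA (pow_eq_zero_iff two_ne_zero |>.mp hlc.symm)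
  have hdeg' : (V.preΨ' p).natDegree = (p ^ 2 - p) / 2 := by
    rw [hsq, natDegree_pow] at hdeg
    omega
  refine ⟨?_, fun i hi ↦ ?_⟩
  · intro hdvd
    have h0 : (V.preΨ' p).coeff ((p ^ 2 - p) / 2) = 0 := by
      rw [hΨ, coeff_map, eq_intCast, (ZMod.intCast_zmod_eq_zero_iff_dvd _ p).mpr hdvd]
    have : (V.preΨ' p).leadingCoeff = 0 := by rw [leadingCoeff, hdeg', h0]
    exact hne (leadingCoeff_eq_zero.mp this)
  · have h0 : (V.preΨ' p).coeff i = 0 := coeff_eq_zero_of_natDegree_lt (by rw [hdeg']; exact hi)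
    rw [hΨ, coeff_map, eq_intCast, ZMod.intCast_zmod_eq_zero_iff_dvd] at h0
    exact h0

/-- **The shape of `ψ_p` transported to a valued field.**  For a `ℤ`-model `M` whose reduction
mod `p` (odd) has non-zero Hasse invariant and a valuation `w` on a field `L` under which the
integers prime to `p` are units and `|n| ≤ 1` for all integers (a place over `p`), the
`p`-division polynomial of `M_L` has coefficients of valuation `≤ 1`, a unit coefficient in degree
`(p² - p)/2`, and coefficients of valuation `≤ |p|` above. [cite: SilvermanAEC2009, V.3.1(a) and V.4.1(a)] -/
theorem valuation_coeff_preΨ'_of_hasseCoeff_ne_zero (M : WeierstrassCurve ℤ) {p : ℕ}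
    [hp : Fact p.Prime] (hp2 : p ≠ 2)
    (hA : (M.map (Int.castRingHom (ZMod p))).hasseCoeff p ≠ 0)
    (hint : ∀ n : ℤ, w (n : L) ≤ 1) (hunit : ∀ n : ℤ, ¬ (p : ℤ) ∣ n → w (n : L) = 1) :
    (∀ i, w (((M.map (Int.castRingHom L)).preΨ' p).coeff i) ≤ 1) ∧
      w (((M.map (Int.castRingHom L)).preΨ' p).coeff ((p ^ 2 - p) / 2)) = 1 ∧
      ∀ i, (p ^ 2 - p) / 2 < i → w (((M.map (Int.castRingHom L)).preΨ' p).coeff i) ≤ w p := by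
  have hcoeff : ∀ i, ((M.map (Int.castRingHom L)).preΨ' p).coeff i = ((M.preΨ' p).coeff i : L) :=
    fun i ↦ by rw [map_preΨ', coeff_map, eq_intCast]
  obtain ⟨hnd, hdvd⟩ := not_dvd_coeff_preΨ'_and_dvd_of_hasseCoeff_ne_zero M hp2 hA
  refine ⟨fun i ↦ by rw [hcoeff]; exact hint _, by rw [hcoeff]; exact hunit _ hnd, fun i hi ↦ ?_⟩
  obtain ⟨c, hc⟩ := hdvd i hi
  rw [hcoeff, hc, Int.cast_mul, Int.cast_natCast, map_mul]
  calc w (p : L) * w (c : L) ≤ w p * 1 := mul_le_mul_right (hint c) _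
    _ = w p := mul_one _

/-! ### The statements for a globally minimal `W/ℚ` at the place `placeOver p` of `ℚ̄` -/

variable (p : ℕ) [hp : Fact p.Prime]

/-- The base change of a globally minimal `W/ℚ` to `ℚ̄` is the base change of its `ℤ`-model.
[folklore] -/
private theorem baseChange_algClosure_eq_map_integralModelInt (W : WeierstrassCurve ℚ) [W.IsGloballyMinimal] :
    W.baseChange (AlgebraicClosure ℚ) =
      (integralModelInt W).map (Int.castRingHom (AlgebraicClosure ℚ)) := by
  conv_lhs => rw [← map_integralModelInt W]
  rw [baseChange, map_map]
  congr 1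

/-- **`|p|_𝔓 · |x(P)|_𝔓^{(p-1)/2} = 1` for the `p`-torsion off the integral locus of a globally
minimal `W/ℚ` at the place `𝔓 = placeOver p` of `ℚ̄`**, when the reduction of `W` mod `p` (odd)
has non-zero Hasse invariant (good ordinary, or multiplicative reduction): Serre 1972, §1.11
(`e = 1`, height one) / Silverman *AEC* IV.6.1 in division-polynomial form.
[cite: Serre1972, §1.11 (Prop. 11, Cor.)] [cite: SilvermanAEC2009, Thm. IV.6.1] -/
theorem valuation_placeOver_mul_pow_eq_one_of_prime_zsmul_eq_zero (W : WeierstrassCurve ℚ)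
    [W.IsGloballyMinimal] (hp2 : p ≠ 2)
    (hA : ((integralModelInt W).map (Int.castRingHom (ZMod p))).hasseCoeff p ≠ 0)
    {x y : AlgebraicClosure ℚ} {h : (W.baseChange (AlgebraicClosure ℚ)).toAffine.Nonsingular x y}
    (hP : (p : ℤ) • (Affine.Point.some x y h : (W.baseChange (AlgebraicClosure ℚ)).toAffine.Point) = 0)
    (hx : 1 < (placeOver p).valuation x) :
    (placeOver p).valuation (p : AlgebraicClosure ℚ) *
      (placeOver p).valuation x ^ ((p - 1) / 2) = 1 := by
  have hint : ∀ n : ℤ, (placeOver p).valuation (n : AlgebraicClosure ℚ) ≤ 1 := fun n ↦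
    ((placeOver p).valuation_le_one_iff _).mpr (intCast_mem _ n)
  have hunit : ∀ n : ℤ, ¬ (p : ℤ) ∣ n → (placeOver p).valuation (n : AlgebraicClosure ℚ) = 1 :=
    fun n hn ↦ valuation_placeOver_intCast_eq_one p hn
  obtain ⟨hcoef, hd, hhigh⟩ := valuation_coeff_preΨ'_of_hasseCoeff_ne_zero
    (w := (placeOver p).valuation) (L := AlgebraicClosure ℚ) (integralModelInt W) hp2 hA hint hunit
  have hpL : (p : AlgebraicClosure ℚ) ≠ 0 := by exact_mod_cast hp.out.ne_zero
  have heq := baseChange_algClosure_eq_map_integralModelInt W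
  -- transport the shape along the equality of the two equations over `ℚ̄`
  have hcoef' : ∀ i, (placeOver p).valuation (((W.baseChange (AlgebraicClosure ℚ)).preΨ' p).coeff i) ≤ 1 :=
    fun i ↦ by rw [heq]; exact hcoef i
  have hd' : (placeOver p).valuation
      (((W.baseChange (AlgebraicClosure ℚ)).preΨ' p).coeff ((p ^ 2 - p) / 2)) = 1 := by
    rw [heq]; exact hd
  have hhigh' : ∀ i, (p ^ 2 - p) / 2 < i → (placeOver p).valuation
      (((W.baseChange (AlgebraicClosure ℚ)).preΨ' p).coeff i) ≤
        (placeOver p).valuation (p : AlgebraicClosure ℚ) := fun i hi ↦ by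
    rw [heq]; exact hhigh i hi
  exact mul_pow_eq_one_of_prime_zsmul_eq_zero_of_one_lt (W.baseChange (AlgebraicClosure ℚ)) hp2 hpL
    hcoef' hd' hhigh' hP hx

/-- **A `p`-torsion point off the integral locus exists** for a globally minimal elliptic `W/ℚ`
at the place `placeOver p`, when the reduction mod `p` (odd) has non-zero Hasse invariant
(Silverman *AEC* V.3.1(a): `Ẽ[p]` has order `p < p² = #E[p]`).
[cite: SilvermanAEC2009, V.3.1(a)] -/
theorem exists_prime_zsmul_eq_zero_one_lt_valuation_placeOver (W : WeierstrassCurve ℚ)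
    [W.IsElliptic] [W.IsGloballyMinimal] (hp2 : p ≠ 2)
    (hA : ((integralModelInt W).map (Int.castRingHom (ZMod p))).hasseCoeff p ≠ 0) :
    ∃ (x y : AlgebraicClosure ℚ) (h : (W.baseChange (AlgebraicClosure ℚ)).toAffine.Nonsingular x y),
      (p : ℤ) • (Affine.Point.some x y h : (W.baseChange (AlgebraicClosure ℚ)).toAffine.Point) = 0 ∧
        1 < (placeOver p).valuation x := by
  have hint : ∀ n : ℤ, (placeOver p).valuation (n : AlgebraicClosure ℚ) ≤ 1 := fun n ↦
    ((placeOver p).valuation_le_one_iff _).mpr (intCast_mem _ n)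
  have hunit : ∀ n : ℤ, ¬ (p : ℤ) ∣ n → (placeOver p).valuation (n : AlgebraicClosure ℚ) = 1 :=
    fun n hn ↦ valuation_placeOver_intCast_eq_one p hn
  obtain ⟨-, hd, -⟩ := valuation_coeff_preΨ'_of_hasseCoeff_ne_zero
    (w := (placeOver p).valuation) (L := AlgebraicClosure ℚ) (integralModelInt W) hp2 hA hint hunit
  have hpL : (p : AlgebraicClosure ℚ) ≠ 0 := by exact_mod_cast hp.out.ne_zero
  have heq := baseChange_algClosure_eq_map_integralModelInt W
  have hd' : (placeOver p).valuation
      (((W.baseChange (AlgebraicClosure ℚ)).preΨ' p).coeff ((p ^ 2 - p) / 2)) = 1 := by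
    rw [heq]; exact hd
  exact exists_prime_zsmul_eq_zero_one_lt (W.baseChange (AlgebraicClosure ℚ)) hp2 hpL
    (valuation_placeOver_natCast_lt_one p) hd'

end WeierstrassCurve

end
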